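import Literature.NumberTheory.EllipticCurves.ZpExtensionGaloisTwistLocal
import Literature.NumberTheory.GaloisCohomology.PoitouTateSelmerStructures
import HarnessLib

/-!
# The non-primitive twisted Selmer structures `𝓕 ≤ 𝓖` on `E[p^J](χ_u)` over a number field, and the
# Poitou–Tate lifting with prescribed local images at `p` and `∞` (Greenberg's `γ'` at finite level)

Topic `NumberTheory/EllipticCurves` (next to `ZpExtensionGaloisTwistLocal`); namespace `WeierstrassCurve`.
DEFINITIONS WITH BODIES + theorems; no named fact, no instance, no notation.

Greenberg (LNM 1716, §4 pp. 122–124, proof of Prop. 4.14/4.15 with the Remark after Prop. 4.13): for the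
twisted module `M = A_s = E[p^∞] ⊗ κ^s` and a finite set of places `Σ ⊇ {v ∣ p} ∪ {v ∣ ∞} ∪ S₀`, the map
`γ' : H¹(F_Σ/F, M) → 𝒫^{Σ'}(M, F) = ∏_{v ∈ Σ'} H¹(F_v, M)/L_v` (`Σ' = Σ − S₀`, i.e. NO local condition at the
places of `S₀` — the non-primitive Selmer group `S'_M`) is studied through Poitou–Tate duality: its
cokernel is controlled by the dual Selmer group `S'_{M^*}(F)` whose local conditions are `L_v^⊥` at
`v ∈ Σ'`, STRICT (`= 0`) at `v ∈ S₀` and unramified elsewhere («changing `L_{v₀}` to `L'_{v₀} = H¹(F_{v₀}, M)`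
… `U'^*_{v₀} = 0`», p. 123). This file writes the corresponding pair of Selmer structures at FINITE level
`M_J = E[p^J](χ_u)` (`W.twistedTorsionGaloisModule p κ J u hu`, file `ZpExtensionGaloisTwistRestrict`) in the
currency of the tree's Poitou–Tate fact `poitouTate_selmerStructure_duality` (`PoitouTateSelmerStructures`):

* `W.twistedKummerSelmerStructure p κ J u hu S₀ = 𝓕`: at an infinite place `w` the kernel of
  `twistedTorsionToLocalH1 … w.Completion : H¹(Γ_{K_w}, E[p^J](χ_u)) → H¹((K_∞)_w, E)` (the classes whose
  image over `K_∞` is Kummer at `w`, file `ZpExtensionGaloisTwistLocal`); at a finite `v ∈ S₀` EVERYTHING;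
  at a finite `v ∋ p`, `v ∉ S₀`, the kernel of `twistedTorsionToLocalH1 … (v.adicCompletion K)`; at every
  other finite place the unramified classes `H¹_ur(K_v, M_J)`;
* `W.twistedRelaxedSelmerStructure p κ J u hu S₀ = 𝓖`: everything at `∞`, at `S₀` and at `v ∋ p`, unramified
  elsewhere — so `H¹_𝓖(K, M_J)` is «`H¹(K_Σ/K, M_J)`», `Σ = S₀ ∪ {v ∣ p} ∪ {v ∣ ∞}`;
* `W.twistedDescentPlaces p S₀ = S`: all infinite places, `S₀`, and the places above `p`
  (`W.placesAbove p`, finite by `Ideal.finite_factors`);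
* bookkeeping: unfolding lemmas, `𝓕 ≤ 𝓖`, both are unramified outside `S` (`IsUnramifiedOutside`); the
  remaining hypothesis `hS` of `SelmerComplement` — outside `S` the module `M_J` is unramified and `p^J ∉ v` —
  is kept as a hypothesis (it holds when `E` has good reduction outside `S₀ ∪ {v ∣ p}`:
  `WeierstrassCurve.natCast_pow_not_mem_and_isUnramifiedAt_twistedTorsionGaloisModule`, file
  `ZpExtensionGaloisTwistUnramifiedProofs`);
* the finite-level `γ'`-lifting itself (`SelmerComplement` ⟹ a class of `H¹_𝓖` with prescribed images
  modulo `𝓕` at `p` and `∞`) is the sibling PROOFS file `ZpExtensionGaloisTwistSelmerStructureProofs.lean`.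

This is brick (β3) of the cell `bsd-2adic` design memo HOME/t42/DESIGN-T42-ADDENDUM-16.md §A16.8 (the
plumbing that turns the level-`ℚ` lifting `LIFT₂` of `Summits/…/ByReductionTypeAtTwoMultTransportTwistedDescentLevel.lean`
into an orthogonality statement). Not here: the orthogonality itself (Greenberg's «`S'_{T^*}(F) = 0`»),
the construction of the targets at `p` (local descent), any named fact.

References: R. Greenberg, *Iwasawa theory for elliptic curves*, LNM 1716 (1999), §4 pp. 122–124
[GreenbergLNM1716]; B. Howard, Compositio Math. 140 (2004), Def. 2.1.10, Thm. 2.1.11 [Howard2004HeegnerKolyvagin];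
J. S. Milne, *Arithmetic Duality Theorems* (2006), I Thm. 4.10 [MilneADT2006].
-/

noncomputable section

open scoped Classical

open NumberField IsDedekindDomain Field
open Literature.NumberTheory.EllipticCurves Literature.NumberTheory.GaloisRepresentations
  Literature.NumberTheory.GaloisCohomology
open Literature.NumberTheory.GaloisRepresentations.DiscreteGaloisModule (unramifiedSubgroup SelmerStructure)

universe u

namespace WeierstrassCurve

variable {K : Type u} [Field K] [NumberField K] (W : WeierstrassCurve K) (p : ℕ) [Fact p.Prime]

/-! ## The finite set of places `S = {v ∣ ∞} ∪ S₀ ∪ {v ∣ p}` -/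

/-- The finite set `{v ∣ p}` of finite places of `K` above `p`, as a `Finset` (plumbing `def`; the set is
finite because its members divide the non-zero ideal `(p)` of the Dedekind domain `𝓞 K`, Mathlib
`Ideal.finite_factors` — cf. the tree's `Literature.NumberTheory.Automorphic.finite_setOf_mem_placesOver`, not
imported here to keep the elliptic-curve files free of the automorphic hierarchy). [cite: NeukirchANT1999, Ch. I §8] -/
def placesAbove : Finset (HeightOneSpectrum (𝓞 K)) :=
  Set.Finite.toFinset (s := {v : HeightOneSpectrum (𝓞 K) | ((p : ℕ) : 𝓞 K) ∈ v.asIdeal}) (by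
    have hI : Ideal.span {((p : ℕ) : 𝓞 K)} ≠ ⊥ := by
      rw [Ne, Ideal.span_singleton_eq_bot]
      exact_mod_cast (Fact.out : p.Prime).ne_zero
    refine (Ideal.finite_factors hI).subset fun v hv ↦ ?_
    simp only [Set.mem_setOf_eq] at hv ⊢
    exact (Ideal.dvd_span_singleton).2 hv)

/-- Membership in `placesAbove p`: `v ∣ p`, i.e. `p ∈ v`. [cite: NeukirchANT1999, Ch. I §8] -/
@[simp] theorem mem_placesAbove_iff (v : HeightOneSpectrum (𝓞 K)) :
    v ∈ placesAbove (K := K) p ↔ ((p : ℕ) : 𝓞 K) ∈ v.asIdeal := by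
  rw [placesAbove, Set.Finite.mem_toFinset, Set.mem_setOf_eq]

variable (S₀ : Finset (HeightOneSpectrum (𝓞 K)))

/-- **The set of places `S = {v ∣ ∞} ∪ S₀ ∪ {v ∣ p}`** of the non-primitive twisted descent (Greenberg's
`Σ`, §4 p. 123: the primes above `p`, the infinite primes, and the omitted primes `S₀`), as a finite set of
`Place K`. [cite: GreenbergLNM1716, §4 pp. 122–124] -/
def twistedDescentPlaces : Finset (Place K) :=
  (Finset.univ : Finset (InfinitePlace K)).map ⟨Sum.inl, Sum.inl_injective⟩ ∪
    (S₀ ∪ placesAbove (K := K) p).map ⟨Sum.inr, Sum.inr_injective⟩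

/-- Every infinite place lies in `S`. [cite: GreenbergLNM1716, §4 p. 123] -/
theorem inl_mem_twistedDescentPlaces (w : InfinitePlace K) :
    (Sum.inl w : Place K) ∈ twistedDescentPlaces (K := K) p S₀ := by
  refine Finset.mem_union_left _ ?_
  exact Finset.mem_map.2 ⟨w, Finset.mem_univ w, rfl⟩

/-- A finite place lies in `S` iff it is in `S₀` or above `p`. [cite: GreenbergLNM1716, §4 p. 123] -/
theorem inr_mem_twistedDescentPlaces_iff (v : HeightOneSpectrum (𝓞 K)) :
    (Sum.inr v : Place K) ∈ twistedDescentPlaces (K := K) p S₀ ↔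
      v ∈ S₀ ∨ ((p : ℕ) : 𝓞 K) ∈ v.asIdeal := by
  rw [twistedDescentPlaces, Finset.mem_union, Finset.mem_map, Finset.mem_map]
  constructor
  · rintro (⟨w, -, hw⟩ | ⟨v', hv', hvv'⟩)
    · exact absurd hw (by simp)
    · have : v' = v := Sum.inr_injective hvv'
      subst this
      rw [Finset.mem_union, mem_placesAbove_iff] at hv'
      exact hv'
  · intro h
    refine Or.inr ⟨v, ?_, rfl⟩
    rw [Finset.mem_union, mem_placesAbove_iff]
    exact h

/-- Places outside `S` are finite places outside `S₀` and prime to `p`. [cite: GreenbergLNM1716, §4 p. 123] -/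
theorem not_mem_twistedDescentPlaces_iff (v : HeightOneSpectrum (𝓞 K)) :
    (Sum.inr v : Place K) ∉ twistedDescentPlaces (K := K) p S₀ ↔
      v ∉ S₀ ∧ ((p : ℕ) : 𝓞 K) ∉ v.asIdeal := by
  rw [inr_mem_twistedDescentPlaces_iff, not_or]

variable (κ : ZpExtension K p) (J : ℕ) (u : ℤ) (hu : (p : ℤ) ∣ u - 1)

/-! ## The Selmer structures `𝓕 ≤ 𝓖` on `E[p^J](χ_u)` -/

/-- **`𝓕`, the non-primitive twisted Kummer structure on `M_J = E[p^J](χ_u)`** (Greenberg's `L_v`, dualised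
finite-level form, §4 p. 123): at an infinite place `w` the classes whose image over `K_∞` is Kummer at `w`
(kernel of `twistedTorsionToLocalH1 … w.Completion`); at `v ∈ S₀` everything (the omitted primes); at
`v ∋ p`, `v ∉ S₀`, the classes whose image over `K_∞` is Kummer at the place above `v` (kernel of
`twistedTorsionToLocalH1 … (v.adicCompletion K)`); unramified classes at every other finite place.
[cite: GreenbergLNM1716, §4 pp. 122–124] -/
def twistedKummerSelmerStructure : SelmerStructure (W.twistedTorsionGaloisModule p κ J u hu) := fun v =>
  match v with
  | Sum.inl w => (W.twistedTorsionToLocalH1 p κ J u hu w.Completion).ker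
  | Sum.inr v =>
      if v ∈ S₀ then ⊤
      else if ((p : ℕ) : 𝓞 K) ∈ v.asIdeal then
        (W.twistedTorsionToLocalH1 p κ J u hu (v.adicCompletion K)).ker
      else unramifiedSubgroup (GaloisRep.toLocal v (W.twistedTorsionGaloisModule p κ J u hu)) 1

/-- **`𝓖`, the relaxed structure on `M_J = E[p^J](χ_u)`**: everything at the infinite places, at `S₀` and at
the places above `p`; unramified classes elsewhere — so that `H¹_𝓖(K, M_J) = H¹(K_Σ/K, M_J)`,
`Σ = S₀ ∪ {v ∣ p} ∪ {v ∣ ∞}` (Greenberg's `H¹(F_Σ/F, M)`, p. 124). [cite: GreenbergLNM1716, §4 pp. 122–124] -/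
def twistedRelaxedSelmerStructure : SelmerStructure (W.twistedTorsionGaloisModule p κ J u hu) := fun v =>
  match v with
  | Sum.inl _ => ⊤
  | Sum.inr v =>
      if v ∈ S₀ then ⊤
      else if ((p : ℕ) : 𝓞 K) ∈ v.asIdeal then ⊤
      else unramifiedSubgroup (GaloisRep.toLocal v (W.twistedTorsionGaloisModule p κ J u hu)) 1

/-! ### Unfolding lemmas -/

/-- `𝓕` at an infinite place. [cite: GreenbergLNM1716, §4 p. 123] -/
@[simp] theorem twistedKummerSelmerStructure_inl (w : InfinitePlace K) :
    W.twistedKummerSelmerStructure p S₀ κ J u hu (Sum.inl w) =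
      (W.twistedTorsionToLocalH1 p κ J u hu w.Completion).ker := rfl

/-- `𝓕` at an omitted prime `v ∈ S₀`: no condition. [cite: GreenbergLNM1716, §4 p. 123] -/
theorem twistedKummerSelmerStructure_inr_of_mem {v : HeightOneSpectrum (𝓞 K)} (hv : v ∈ S₀) :
    W.twistedKummerSelmerStructure p S₀ κ J u hu (Sum.inr v) = ⊤ := by
  change (if v ∈ S₀ then ⊤ else _) = _
  rw [if_pos hv]

/-- `𝓕` at a place above `p` outside `S₀`: the twisted Kummer condition over `K_∞`.
[cite: GreenbergLNM1716, §4 p. 123] -/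
theorem twistedKummerSelmerStructure_inr_of_mem_asIdeal {v : HeightOneSpectrum (𝓞 K)} (hv : v ∉ S₀)
    (hpv : ((p : ℕ) : 𝓞 K) ∈ v.asIdeal) :
    W.twistedKummerSelmerStructure p S₀ κ J u hu (Sum.inr v) =
      (W.twistedTorsionToLocalH1 p κ J u hu (v.adicCompletion K)).ker := by
  change (if v ∈ S₀ then ⊤ else if ((p : ℕ) : 𝓞 K) ∈ v.asIdeal then _ else _) = _
  rw [if_neg hv, if_pos hpv]

/-- `𝓕` at a finite place outside `S₀ ∪ {v ∣ p}`: unramified classes. [cite: GreenbergLNM1716, §4 p. 123] -/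
theorem twistedKummerSelmerStructure_inr_of_not_mem {v : HeightOneSpectrum (𝓞 K)} (hv : v ∉ S₀)
    (hpv : ((p : ℕ) : 𝓞 K) ∉ v.asIdeal) :
    W.twistedKummerSelmerStructure p S₀ κ J u hu (Sum.inr v) =
      unramifiedSubgroup (GaloisRep.toLocal v (W.twistedTorsionGaloisModule p κ J u hu)) 1 := by
  change (if v ∈ S₀ then ⊤ else if ((p : ℕ) : 𝓞 K) ∈ v.asIdeal then _ else _) = _
  rw [if_neg hv, if_neg hpv]

/-- `𝓖` at an infinite place: no condition. [cite: GreenbergLNM1716, §4 p. 124] -/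
@[simp] theorem twistedRelaxedSelmerStructure_inl (w : InfinitePlace K) :
    W.twistedRelaxedSelmerStructure p S₀ κ J u hu (Sum.inl w) = ⊤ := rfl

/-- `𝓖` at `v ∈ S₀`: no condition. [cite: GreenbergLNM1716, §4 p. 124] -/
theorem twistedRelaxedSelmerStructure_inr_of_mem {v : HeightOneSpectrum (𝓞 K)} (hv : v ∈ S₀) :
    W.twistedRelaxedSelmerStructure p S₀ κ J u hu (Sum.inr v) = ⊤ := by
  change (if v ∈ S₀ then ⊤ else _) = _
  rw [if_pos hv]

/-- `𝓖` at a place above `p`: no condition. [cite: GreenbergLNM1716, §4 p. 124] -/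
theorem twistedRelaxedSelmerStructure_inr_of_mem_asIdeal {v : HeightOneSpectrum (𝓞 K)}
    (hpv : ((p : ℕ) : 𝓞 K) ∈ v.asIdeal) :
    W.twistedRelaxedSelmerStructure p S₀ κ J u hu (Sum.inr v) = ⊤ := by
  change (if v ∈ S₀ then ⊤ else if ((p : ℕ) : 𝓞 K) ∈ v.asIdeal then _ else _) = _
  by_cases hv : v ∈ S₀
  · rw [if_pos hv]
  · rw [if_neg hv, if_pos hpv]

/-- `𝓖` at a finite place outside `S₀ ∪ {v ∣ p}`: unramified classes. [cite: GreenbergLNM1716, §4 p. 124] -/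
theorem twistedRelaxedSelmerStructure_inr_of_not_mem {v : HeightOneSpectrum (𝓞 K)} (hv : v ∉ S₀)
    (hpv : ((p : ℕ) : 𝓞 K) ∉ v.asIdeal) :
    W.twistedRelaxedSelmerStructure p S₀ κ J u hu (Sum.inr v) =
      unramifiedSubgroup (GaloisRep.toLocal v (W.twistedTorsionGaloisModule p κ J u hu)) 1 := by
  change (if v ∈ S₀ then ⊤ else if ((p : ℕ) : 𝓞 K) ∈ v.asIdeal then _ else _) = _
  rw [if_neg hv, if_neg hpv]

/-- `𝓖` is everything at every place of `S`. [cite: GreenbergLNM1716, §4 p. 124] -/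
theorem twistedRelaxedSelmerStructure_eq_top_of_mem {v : Place K}
    (hv : v ∈ twistedDescentPlaces (K := K) p S₀) :
    W.twistedRelaxedSelmerStructure p S₀ κ J u hu v = ⊤ := by
  rcases v with w | v
  · rfl
  · rcases (inr_mem_twistedDescentPlaces_iff p S₀ v).1 hv with h | h
    · exact W.twistedRelaxedSelmerStructure_inr_of_mem p S₀ κ J u hu h
    · exact W.twistedRelaxedSelmerStructure_inr_of_mem_asIdeal p S₀ κ J u hu h

/-! ### `𝓕 ≤ 𝓖`, both unramified outside `S` -/

/-- `𝓕 ≤ 𝓖` place by place. [cite: GreenbergLNM1716, §4 pp. 123–124] -/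
theorem twistedKummerSelmerStructure_le_relaxed :
    W.twistedKummerSelmerStructure p S₀ κ J u hu ≤ W.twistedRelaxedSelmerStructure p S₀ κ J u hu := by
  intro v
  rcases v with w | v
  · rw [twistedRelaxedSelmerStructure_inl]
    exact le_top
  · by_cases hv : v ∈ S₀
    · rw [W.twistedRelaxedSelmerStructure_inr_of_mem p S₀ κ J u hu hv]
      exact le_top
    · by_cases hpv : ((p : ℕ) : 𝓞 K) ∈ v.asIdeal
      · rw [W.twistedRelaxedSelmerStructure_inr_of_mem_asIdeal p S₀ κ J u hu hpv]
        exact le_top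
      · rw [W.twistedKummerSelmerStructure_inr_of_not_mem p S₀ κ J u hu hv hpv,
          W.twistedRelaxedSelmerStructure_inr_of_not_mem p S₀ κ J u hu hv hpv]

/-- `𝓕` is a Selmer structure with `Σ(𝓕) ⊆ S` (Howard Def. 2.1.10). [cite: Howard2004HeegnerKolyvagin, Def. 2.1.10] -/
theorem isUnramifiedOutside_twistedKummerSelmerStructure :
    (W.twistedKummerSelmerStructure p S₀ κ J u hu).IsUnramifiedOutside
      (twistedDescentPlaces (K := K) p S₀) := by
  refine ⟨inl_mem_twistedDescentPlaces p S₀, fun v hv ↦ ?_⟩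
  rw [not_mem_twistedDescentPlaces_iff] at hv
  exact W.twistedKummerSelmerStructure_inr_of_not_mem p S₀ κ J u hu hv.1 hv.2

/-- `𝓖` is a Selmer structure with `Σ(𝓖) ⊆ S` (Howard Def. 2.1.10). [cite: Howard2004HeegnerKolyvagin, Def. 2.1.10] -/
theorem isUnramifiedOutside_twistedRelaxedSelmerStructure :
    (W.twistedRelaxedSelmerStructure p S₀ κ J u hu).IsUnramifiedOutside
      (twistedDescentPlaces (K := K) p S₀) := by
  refine ⟨inl_mem_twistedDescentPlaces p S₀, fun v hv ↦ ?_⟩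
  rw [not_mem_twistedDescentPlaces_iff] at hv
  exact W.twistedRelaxedSelmerStructure_inr_of_not_mem p S₀ κ J u hu hv.1 hv.2

/-! ### What membership in `H¹_𝓖` and in `𝓕_v` say -/

/-- A class of `H¹_𝓖(K, M_J)` is unramified at every finite `v ∉ S₀` prime to `p` (level-`K` localisation
`galoisCohomology.res … (v.adicCompletion K)`, definitionally the localisation at the place `Sum.inr v`).
[cite: GreenbergLNM1716, §4 p. 124] -/
theorem res_mem_unramifiedSubgroup_of_mem_selmerGroup_relaxed
    {x : galoisCohomology (W.twistedTorsionGaloisModule p κ J u hu) 1}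
    (hx : x ∈ (W.twistedRelaxedSelmerStructure p S₀ κ J u hu).selmerGroup)
    {v : HeightOneSpectrum (𝓞 K)} (hv : v ∉ S₀) (hpv : ((p : ℕ) : 𝓞 K) ∉ v.asIdeal) :
    galoisCohomology.res (W.twistedTorsionGaloisModule p κ J u hu) (v.adicCompletion K) 1 x ∈
      unramifiedSubgroup ((W.twistedTorsionGaloisModule p κ J u hu).restrictField (v.adicCompletion K)) 1 := by
  rw [SelmerStructure.mem_selmerGroup_iff] at hx
  have h := hx (Sum.inr v)
  rw [W.twistedRelaxedSelmerStructure_inr_of_not_mem p S₀ κ J u hu hv hpv] at h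
  exact h

/-- At a place `v ∋ p` outside `S₀`, `a − b ∈ 𝓕_v` says the two classes have the same image in
`H¹((K_∞)_v, E)`. [cite: GreenbergLNM1716, §4 p. 124] -/
theorem twistedTorsionToLocalH1_eq_of_sub_mem_inr {v : HeightOneSpectrum (𝓞 K)} (hv : v ∉ S₀)
    (hpv : ((p : ℕ) : 𝓞 K) ∈ v.asIdeal)
    {a b : galoisCohomology
      ((W.twistedTorsionGaloisModule p κ J u hu).restrictField (v.adicCompletion K)) 1}
    (h : a - b ∈ W.twistedKummerSelmerStructure p S₀ κ J u hu (Sum.inr v)) :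
    W.twistedTorsionToLocalH1 p κ J u hu (v.adicCompletion K) a =
      W.twistedTorsionToLocalH1 p κ J u hu (v.adicCompletion K) b := by
  rw [W.twistedKummerSelmerStructure_inr_of_mem_asIdeal p S₀ κ J u hu hv hpv] at h
  have h2 : W.twistedTorsionToLocalH1 p κ J u hu (v.adicCompletion K) (a - b) = 0 := h
  rwa [map_sub, sub_eq_zero] at h2

/-- At an infinite place `w`, `a − b ∈ 𝓕_w` says the two classes have the same image in `H¹((K_∞)_w, E)`.
[cite: GreenbergLNM1716, §4 p. 124] -/
theorem twistedTorsionToLocalH1_eq_of_sub_mem_inl (w : InfinitePlace K)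
    {a b : galoisCohomology ((W.twistedTorsionGaloisModule p κ J u hu).restrictField w.Completion) 1}
    (h : a - b ∈ W.twistedKummerSelmerStructure p S₀ κ J u hu (Sum.inl w)) :
    W.twistedTorsionToLocalH1 p κ J u hu w.Completion a =
      W.twistedTorsionToLocalH1 p κ J u hu w.Completion b := by
  have h2 : W.twistedTorsionToLocalH1 p κ J u hu w.Completion (a - b) = 0 := h
  rwa [map_sub, sub_eq_zero] at h2

end WeierstrassCurve

end
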